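import Mathlib.LinearAlgebra.FreeModule.Finite.Matrix
import Mathlib.LinearAlgebra.FiniteDimensional.Lemmas
import Mathlib.RingTheory.AdjoinRoot
import Mathlib.FieldTheory.Minpoly.Field
import Mathlib.Algebra.Polynomial.SpecificDegree
import HarnessLib

/-!
# The commutant of an endomorphism `φ` with `φ³ = qφ`, `q < 0`, on the range of `φ`: its dimension is
# `(dim range φ)² / 2`

Family `hodge`, layer `Literature/RepresentationTheory/GeneralLinear`; THEOREMS ONLY (no definition, no named fact;
D-0026).  Pure linear algebra over `ℚ`, written for the cell `pub-hodgecm2` (COR-CM) lane MT-RANK-FIVE, where it is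
applied to the rational central element `φ` of the Hodge Lie algebra of a weight-one Hodge structure of Hodge-group
rank `4` (`Motives/HodgeLieWeightOneRankFourRange`): there `φ³ = qφ` with `q ∈ ℚ_{<0}`, `range φ` is a vector space
over the imaginary quadratic field `k = ℚ[T]/(T² − q)` (through `φ`), and the Hodge endomorphisms supported on
`range φ` are exactly the `k`-linear ones.

* `two_mul_finrank_commutant_range` — for `φ ∈ End_ℚ V` with `φ³ = qφ`, `q < 0`:
  **`2 · dim_ℚ {a ∈ End_ℚ V | aφ = φa, aφ² = qa} = (dim_ℚ range φ)²`**.  The subspace consists of the endomorphisms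
  supported on `range φ` (`a = q⁻¹ a φ²` kills `ker φ` and maps into `range φ`) commuting with `φ`; restriction
  identifies it with the commutant of `t = φ|_{range φ}`, `t² = q`, i.e. with `End_k(range φ)` for the field
  `k = ℚ[T]/(T² − q)` acting through `t`, of `ℚ`-dimension `2 · (dim_k range φ)² = (dim_ℚ range φ)² / 2`
  (tower law; the centraliser of `k` in `End_ℚ(U)` is `End_k(U)`, Pierce §12.7).

## References

* [Pierce1982] R. S. Pierce, *Associative Algebras*, GTM 88 (1982), §12.7 (centralisers, double centraliser theorem).
* [MumfordAV1970] D. Mumford, *Abelian Varieties* (1970), §19 (`End⁰` and the rational representation).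
-/

namespace Literature.RepresentationTheory.GeneralLinear

open Polynomial Module

universe u

variable {V : Type u} [AddCommGroup V] [Module ℚ V] [FiniteDimensional ℚ V]

/-- **`2 · dim_ℚ {a | aφ = φa, aφ² = qa} = (dim_ℚ range φ)²`** for `φ³ = qφ` with `q < 0` (see the module
docstring). [cite: Pierce1982, §12.7] -/
theorem two_mul_finrank_commutant_range (φ : Module.End ℚ V) {q : ℚ} (hq : q < 0) (hφ : φ * φ * φ = q • φ)
    {C : Submodule ℚ (Module.End ℚ V)} (hC : ∀ a, a ∈ C ↔ a * φ = φ * a ∧ a * (φ * φ) = q • a) :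
    2 * Module.finrank ℚ C = Module.finrank ℚ (LinearMap.range φ) ^ 2 := by
  classical
  have hq0 : q ≠ 0 := hq.ne
  -- the range `U` of `φ` and `t = φ|_U` with `t² = q`
  set U : Submodule ℚ V := LinearMap.range φ with hUdef
  have hU : ∀ x ∈ U, φ x ∈ U := fun x _ => LinearMap.mem_range_self φ x
  set t : Module.End ℚ U := φ.restrict hU with htdef
  have ht_coe : ∀ u : U, ((t u : U) : V) = φ u := fun u => rfl
  have hφ3 : ∀ v, φ (φ (φ v)) = q • φ v := fun v => by
    rw [← Module.End.mul_apply, ← Module.End.mul_apply, hφ, LinearMap.smul_apply]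
  have htt : t * t = q • (1 : Module.End ℚ U) := by
    refine LinearMap.ext fun u => Subtype.ext ?_
    obtain ⟨v, hv⟩ := (LinearMap.mem_range).1 u.2
    rw [Module.End.mul_apply, ht_coe, ht_coe, LinearMap.smul_apply, Module.End.one_apply, Submodule.coe_smul, ← hv, hφ3]
  -- the field `k = ℚ[T]/(T² - q)` and its action on `U` through `t`
  set Pq : ℚ[X] := X ^ 2 - Polynomial.C q with hPq
  have hPq2 : Pq.natDegree = 2 := by rw [hPq]; exact natDegree_X_pow_sub_C
  have hPq0 : Pq ≠ 0 := fun h => by rw [h, natDegree_zero] at hPq2; exact absurd hPq2 (by norm_num)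
  have hnoroot : ∀ r : ℚ, ¬ Pq.IsRoot r := by
    intro r hr
    have h : r ^ 2 - q = 0 := by simpa [hPq] using hr
    nlinarith [sq_nonneg r]
  have hirr : Irreducible Pq := irreducible_of_degree_le_three_of_not_isRoot (by rw [hPq2]; decide) hnoroot
  haveI : Fact (Irreducible Pq) := ⟨hirr⟩
  let k := AdjoinRoot Pq
  have hk2 : Module.finrank ℚ k = 2 := by
    rw [(AdjoinRoot.powerBasis hPq0).finrank, AdjoinRoot.powerBasis_dim, hPq2]
  have hPt : aeval t Pq = 0 := by
    rw [hPq, map_sub, map_pow, aeval_X, aeval_C, pow_two, htt, Algebra.algebraMap_eq_smul_one, sub_self]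
  have hker : ∀ p ∈ (Ideal.span {Pq} : Ideal ℚ[X]), (aeval t).toRingHom p = 0 := by
    intro p hp
    obtain ⟨r, rfl⟩ := Ideal.mem_span_singleton'.1 hp
    change aeval t (r * Pq) = 0
    rw [map_mul, hPt, mul_zero]
  let ρ : k →+* Module.End ℚ U := Ideal.Quotient.lift (Ideal.span {Pq}) (aeval t).toRingHom hker
  have hρmk : ∀ p : ℚ[X], ρ (AdjoinRoot.mk Pq p) = aeval t p := fun p => Ideal.Quotient.lift_mk _ _ _
  have hρroot : ρ (AdjoinRoot.root Pq) = t := by rw [AdjoinRoot.root, hρmk, aeval_X]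
  have hρof : ∀ x : ℚ, ρ (algebraMap ℚ k x) = algebraMap ℚ (Module.End ℚ U) x := fun x => by
    rw [AdjoinRoot.algebraMap_eq, show AdjoinRoot.of Pq x = AdjoinRoot.mk Pq (Polynomial.C x) from
      (AdjoinRoot.mk_C x).symm, hρmk, aeval_C]
  letI instk : Module k U := Module.compHom U ρ
  have hsmul : ∀ (c : k) (u : U), c • u = ρ c u := fun c u => rfl
  haveI : IsScalarTower ℚ k U := ⟨fun x c u => by
    rw [hsmul, hsmul, Algebra.smul_def, map_mul, hρof, Module.End.mul_apply, Algebra.algebraMap_eq_smul_one,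
      LinearMap.smul_apply, Module.End.one_apply]⟩
  haveI : SMulCommClass k ℚ U := ⟨fun c x u => by rw [hsmul, hsmul, map_smul]⟩
  haveI : SMulCommClass ℚ k U := SMulCommClass.symm _ _ _
  haveI : Module.Finite k U := Module.Finite.of_restrictScalars_finite ℚ k U
  -- every element of `k` acts through a polynomial in `t`, so maps commuting with `t` are `k`-linear
  have hk_lin : ∀ (a' : Module.End ℚ U), a' * t = t * a' → ∀ (c : k) (u : U), a' (c • u) = c • a' u := by
    intro a' ha' c u
    induction c using AdjoinRoot.induction_on with
    | ih p =>
      rw [hsmul, hsmul, hρmk]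
      induction p using Polynomial.induction_on' with
      | add p₁ p₂ h₁ h₂ => rw [map_add, LinearMap.add_apply, map_add, h₁, h₂, LinearMap.add_apply]
      | monomial m x =>
        rw [aeval_monomial, Module.End.mul_apply, Module.End.mul_apply]
        have hcomm : a' * t ^ m = t ^ m * a' := by
          induction m with
          | zero => rw [pow_zero, mul_one, one_mul]
          | succ m ih => rw [pow_succ, ← mul_assoc, ih, mul_assoc, ha', ← mul_assoc]
        rw [Algebra.algebraMap_eq_smul_one, LinearMap.smul_apply, LinearMap.smul_apply, Module.End.one_apply,
          Module.End.one_apply, map_smul, ← Module.End.mul_apply a' (t ^ m), hcomm, Module.End.mul_apply]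
  -- the commutant of `t` in `End_ℚ U` is `End_k U`
  set Ct : Submodule ℚ (Module.End ℚ U) :=
    { carrier := {a' | a' * t = t * a'}
      add_mem' := fun {a b} ha hb => by
        change (a + b) * t = t * (a + b); rw [add_mul, mul_add, ha, hb]
      zero_mem' := by change (0 : Module.End ℚ U) * t = t * 0; rw [zero_mul, mul_zero]
      smul_mem' := fun x a ha => by
        change (x • a) * t = t * (x • a); rw [smul_mul_assoc, mul_smul_comm, ha] } with hCtdef
  have hCt : ∀ a', a' ∈ Ct ↔ a' * t = t * a' := fun a' => Iff.rfl
  let Θ : Ct ≃ₗ[ℚ] (U →ₗ[k] U) :=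
    { toFun := fun a' =>
        { toFun := fun u => (a' : Module.End ℚ U) u
          map_add' := fun u v => map_add _ u v
          map_smul' := fun c u => hk_lin _ a'.2 c u }
      map_add' := fun a b => LinearMap.ext fun u => rfl
      map_smul' := fun x a => LinearMap.ext fun u => rfl
      invFun := fun f => ⟨f.restrictScalars ℚ, by
        rw [hCt]
        refine LinearMap.ext fun u => ?_
        rw [Module.End.mul_apply, Module.End.mul_apply, LinearMap.restrictScalars_apply, LinearMap.restrictScalars_apply,
          ← hρroot, ← hsmul, ← hsmul, map_smul]⟩
      left_inv := fun a' => rfl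
      right_inv := fun f => rfl }
  -- dimension count on `U`
  have hdimCt : Module.finrank ℚ Ct = 2 * Module.finrank k U ^ 2 := by
    rw [Θ.finrank_eq, ← Module.finrank_mul_finrank ℚ k (U →ₗ[k] U), hk2, Module.finrank_linearMap, pow_two]
  have hdimU : Module.finrank ℚ U = 2 * Module.finrank k U := by
    rw [← Module.finrank_mul_finrank ℚ k U, hk2]
  -- restriction identifies `C` with `Ct`
  have hCU : ∀ a ∈ C, ∀ x ∈ U, a x ∈ U := by
    intro a ha x hx
    obtain ⟨v, rfl⟩ := (LinearMap.mem_range).1 hx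
    rw [← Module.End.mul_apply, ((hC a).1 ha).1, Module.End.mul_apply]
    exact LinearMap.mem_range_self φ _
  have hφφU : ∀ v, φ (φ v) ∈ U := fun v => LinearMap.mem_range_self φ _
  set π : V →ₗ[ℚ] U := LinearMap.codRestrict U (q⁻¹ • (φ * φ)) (fun v => by
    rw [LinearMap.smul_apply, Module.End.mul_apply]; exact U.smul_mem _ (hφφU v)) with hπdef
  have hπ_coe : ∀ v, ((π v : U) : V) = q⁻¹ • φ (φ v) := fun v => rfl
  have hπU : ∀ u : U, π (u : V) = u := by
    intro u
    apply Subtype.ext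
    obtain ⟨v, hv⟩ := (LinearMap.mem_range).1 u.2
    have hu : (u : V) = φ v := hv.symm
    rw [hπ_coe, hu, hφ3, smul_smul, inv_mul_cancel₀ hq0, one_smul]
  have hπφ : ∀ v, π (φ v) = t (π v) := by
    intro v
    apply Subtype.ext
    rw [hπ_coe, ht_coe, hπ_coe, map_smul]
  let Ψ : C ≃ₗ[ℚ] Ct :=
    { toFun := fun a => ⟨(a : Module.End ℚ V).restrict (hCU _ a.2), by
        rw [hCt]
        refine LinearMap.ext fun u => Subtype.ext ?_
        change (a : Module.End ℚ V) (φ u) = φ ((a : Module.End ℚ V) u)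
        rw [← Module.End.mul_apply, ((hC _).1 a.2).1, Module.End.mul_apply]⟩
      map_add' := fun a b => Subtype.ext (LinearMap.ext fun u => Subtype.ext rfl)
      map_smul' := fun x a => Subtype.ext (LinearMap.ext fun u => Subtype.ext rfl)
      invFun := fun a' => ⟨U.subtype ∘ₗ (a' : Module.End ℚ U) ∘ₗ π, by
        rw [hC]
        constructor
        · refine LinearMap.ext fun v => ?_
          change (((a' : Module.End ℚ U) (π (φ v)) : U) : V) = φ (((a' : Module.End ℚ U) (π v) : U) : V)
          rw [hπφ, ← Module.End.mul_apply, (hCt _).1 a'.2, Module.End.mul_apply, ht_coe]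
        · refine LinearMap.ext fun v => ?_
          change (((a' : Module.End ℚ U) (π (φ (φ v))) : U) : V) = q • (((a' : Module.End ℚ U) (π v) : U) : V)
          have h : π (φ (φ v)) = q • π v := by
            apply Subtype.ext
            rw [hπ_coe, hφ3, Submodule.coe_smul, hπ_coe, smul_smul, smul_smul, mul_comm]
          rw [h, map_smul, Submodule.coe_smul]⟩
      left_inv := fun a => by
        apply Subtype.ext
        refine LinearMap.ext fun v => ?_
        change ((a : Module.End ℚ V) ((π v : U) : V)) = (a : Module.End ℚ V) v
        rw [hπ_coe, map_smul]
        change q⁻¹ • ((a : Module.End ℚ V) * (φ * φ)) v = _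
        rw [((hC _).1 a.2).2, LinearMap.smul_apply, smul_smul, inv_mul_cancel₀ hq0, one_smul]
      right_inv := fun a' => by
        apply Subtype.ext
        refine LinearMap.ext fun u => Subtype.ext ?_
        change (((a' : Module.End ℚ U) (π (u : V)) : U) : V) = (((a' : Module.End ℚ U) u : U) : V)
        rw [hπU] }
  rw [Ψ.finrank_eq, hdimCt, hdimU]
  ring

end Literature.RepresentationTheory.GeneralLinear
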